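import Summits.BirchSwinnertonDyer.BirchSwinnertonDyer.Theorems.ThetaPartnerAtTwoSignedControlAtTwoMuRealCardFour
import HarnessLib

/-!
# Milne *ADT* I Thm. 4.10(b) for `E[2]` over ANY number field when `E` has a rational point of order `2`

Route `ThetaPartnerAtTwo`, crux K4 `SignedControlAtTwo` (stmt-BirchSwinnertonDyer-20309), line `eulerchar` v10, lead
`bsd-wall-tp2-p3` g4 (`--supports stmt-BirchSwinnertonDyer-20309`, helper).  File 6 of the real-place packet: the hypothesis
`hpow` («every `σ ∈ Γ_K` acts on `E[2]` with `2`-power order») of file 5's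
`middleExact_canonical_torsionGaloisModule_two_of_pow` DISCHARGED from a Galois-fixed non-zero `2`-torsion point.

* `AddMonoidHom.apply_apply_eq_self_of_card_four` — group theory: an injective additive endomorphism of a group of
  order `4` and exponent `2` fixing a non-zero element is an involution (`M = {0, P, m, m + P}`; `f m ∈ {m, m + P}`);
* `pow_two_eq_one_of_fixed` — hence every `σ` acts on such a Galois module `M` with `(ρ σ)² = 1`;
* **`middleExact_canonical_torsionGaloisModule_two_of_fixedPoint`** — Milne I 4.10(b) `Ker γ¹ ⊆ Im β¹` for `E[2]`, THE
  canonical invariant maps at level `2`, every admissible `S ⊇ {v ∣ ∞}`, over EVERY number field `K` (real places allowed),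
  for every elliptic `E/K` with a point `P ∈ E[2]`, `P ≠ 0`, fixed by `Γ_K` (a `K`-rational `2`-torsion point).

HONEST FRAMING. THEOREMS ONLY; elementary group theory + file 5; NOT K4's habitat (there `E(ℚ)[2] = 0` and the missing input
is the archimedean descent, `PT-AT-2-REALPLACES.md` (N1)); no item closes; BSD is not proved by any of this.

References: [MilneADT2006] I Thm. 4.10(b); [SilvermanAEC2009] III.6.4, VIII §1.
-/

noncomputable section

open CategoryTheory Function NumberField IsDedekindDomain
open scoped NumberField ContRepresentation

set_option linter.dupNamespace false
set_option autoImplicit false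

namespace Summit.BirchSwinnertonDyer.BirchSwinnertonDyer.Theorems.SignedEC.MuReal

open Field
open Literature.NumberTheory.GaloisRepresentations Literature.NumberTheory.GaloisCohomology
open Literature.NumberTheory.GaloisRepresentations.DiscreteGaloisModule (mu MuCarrier TateDual tateDual
  localTatePairingZMod unramifiedSubgroup)
open _root_.TopRep _root_.ContRepresentation _root_.ContinuousCohomology
open Literature.NumberTheory.EllipticCurves WeierstrassCurve

/-! ## §1. Group theory on `(ℤ/2)²` -/

/-- **An injective additive endomorphism of a group of order `4` and exponent `2` that fixes a non-zero element is an
involution**: `M = {0, P, m, m + P}`, so `f m ∈ {m, m + P}` and in either case `f (f m) = m` (`2P = 0`). [folklore] -/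
theorem AddMonoidHom.apply_apply_eq_self_of_card_four {M : Type} [AddCommGroup M] [Finite M]
    (h2 : ∀ m : M, 2 • m = 0) (hcard : Nat.card M = 4) (f : M →+ M) (hf : Injective f)
    {P : M} (hP0 : P ≠ 0) (hP : f P = P) (m : M) : f (f m) = m := by
  classical
  haveI := Fintype.ofFinite M
  have hPP : P + P = 0 := by rw [← two_nsmul]; exact h2 P
  by_cases hm0 : m = 0
  · subst hm0; rw [map_zero, map_zero]
  by_cases hmP : m = P
  · subst hmP; rw [hP, hP]
  -- the four elements `0, P, m, m + P` are distinct, hence exhaust `M`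
  have h1 : m + P ≠ 0 := fun h => hmP (by
    have : m = -P := eq_neg_of_add_eq_zero_left h
    rw [this, neg_eq_iff_add_eq_zero, hPP])
  have h2' : m + P ≠ P := fun h => hm0 (by simpa using h)
  have h3 : m + P ≠ m := fun h => hP0 (by simpa using h)
  set T : Finset M := {0, P, m, m + P} with hT
  have hTcard : T.card = 4 := by
    rw [hT, Finset.card_insert_of_notMem, Finset.card_insert_of_notMem, Finset.card_insert_of_notMem,
      Finset.card_singleton]
    · simpa using h3.symm
    · simp only [Finset.mem_insert, Finset.mem_singleton, not_or]; exact ⟨fun h => hmP h.symm, fun h => h2' h.symm⟩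
    · simp only [Finset.mem_insert, Finset.mem_singleton, not_or]
      exact ⟨fun h => hP0 h.symm, fun h => hm0 h.symm, fun h => h1 h.symm⟩
  have hTuniv : T = Finset.univ := Finset.eq_univ_of_card T (by rw [hTcard, ← Nat.card_eq_fintype_card, hcard])
  have hfm : f m ∈ T := by rw [hTuniv]; exact Finset.mem_univ _
  have hfm0 : f m ≠ 0 := fun h => hm0 (hf (by rw [h, map_zero]))
  have hfmP : f m ≠ P := fun h => hmP (hf (by rw [h, hP]))
  rw [hT] at hfm
  simp only [Finset.mem_insert, Finset.mem_singleton] at hfm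
  rcases hfm with h | h | h | h
  · exact absurd h hfm0
  · exact absurd h hfmP
  · rw [h, h]
  · rw [h, map_add, h, hP, add_assoc, hPP, add_zero]

/-! ## §2. Galois modules of order `4` and exponent `2` with a fixed non-zero vector -/

variable {K : Type} [Field K]

/-- **Every `σ ∈ Γ_K` acts with `(ρ σ)² = 1` on a Galois module of order `4` and exponent `2` having a non-zero
`Γ_K`-fixed vector** — the hypothesis `hpow` of `middleExact_canonical_of_card_eq_four_of_pow` with `k = 1`. [folklore] -/
theorem pow_two_eq_one_of_fixed {M : Type} [AddCommGroup M] [TopologicalSpace M] [DiscreteTopology M] [Finite M]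
    (ρ : DiscreteGaloisModule K M) (h2 : ∀ m : M, 2 • m = 0) (hcard : Nat.card M = 2 ^ 2)
    {P : M} (hP0 : P ≠ 0) (hP : ∀ σ : absoluteGaloisGroup K, ρ σ P = P) (σ : absoluteGaloisGroup K) :
    ∃ k : ℕ, (ρ σ) ^ (2 ^ k) = 1 := by
  refine ⟨1, ?_⟩
  have hmul : ∀ (x y : absoluteGaloisGroup K) (m : M), ρ (x * y) m = ρ x (ρ y m) := fun x y m => by
    change ρ.toRepresentation (x * y) m = ρ.toRepresentation x (ρ.toRepresentation y m)
    rw [map_mul]; rfl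
  have hone : ∀ m : M, ρ 1 m = m := fun m => by
    change ρ.toRepresentation 1 m = m
    rw [map_one]; rfl
  have hinj : Injective (ρ σ) := fun m m' h => by
    have h' := congrArg (ρ σ⁻¹) h
    rwa [← hmul, ← hmul, inv_mul_cancel, hone, hone] at h'
  rw [pow_one, pow_two]
  refine LinearMap.ext fun m => ?_
  rw [Module.End.mul_apply, Module.End.one_apply]
  exact AddMonoidHom.apply_apply_eq_self_of_card_four h2 (by norm_num [hcard]) (ρ σ).toAddMonoidHom hinj hP0
    (hP σ) m

/-! ## §3. `E[2]` with a rational `2`-torsion point -/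

variable [NumberField K]

/-- **Milne *ADT* I Thm. 4.10(b) `Ker γ¹ ⊆ Im β¹` for `M = E[2]` over ANY number field `K` for an elliptic curve `E/K` with a
`K`-RATIONAL POINT OF ORDER `2`** (`P ∈ E[2]`, `P ≠ 0`, `σ • P = P` for all `σ ∈ Γ_K`), THE canonical invariant maps at level
`2`, every admissible `S ⊇ {v ∣ ∞}` — real places allowed (`middleExact_canonical_torsionGaloisModule_two_of_pow` +
`pow_two_eq_one_of_fixed`; `#E[2] = 4`, `2·E[2] = 0`). [cite: MilneADT2006, Ch. I, Thm. 4.10(b)] [cite: SilvermanAEC2009, Cor. III.6.4(b)] -/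
theorem middleExact_canonical_torsionGaloisModule_two_of_fixedPoint [Fact (Nat.Prime 2)] (W : WeierstrassCurve K)
    [W.IsElliptic] [Finite (geomTorsion W ((2 : ℕ) : ℤ))]
    (P : geomTorsion W ((2 : ℕ) : ℤ)) (hP0 : P ≠ 0) (hP : ∀ σ : absoluteGaloisGroup K, σ • P = P)
    {S : Finset (Place K)} (hSinf : ∀ w : InfinitePlace K, (Sum.inl w : Place K) ∈ S)
    (hS : ∀ v : HeightOneSpectrum (𝓞 K), (Sum.inr v : Place K) ∉ S →
      ((2 : ℕ) : 𝓞 K) ∉ v.asIdeal ∧ GaloisRep.IsUnramifiedAt v (W.torsionGaloisModule ((2 : ℕ) : ℤ)))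
    (t : Π v : Place K, galoisCohomology ((W.torsionGaloisModule ((2 : ℕ) : ℤ)).toLocal v) 1)
    (horth : ∀ y : galoisCohomology ((W.torsionGaloisModule ((2 : ℕ) : ℤ)).tateDual 2) 1,
      (∀ v : HeightOneSpectrum (𝓞 K), (Sum.inr v : Place K) ∉ S →
        galoisCohomology.localization ((W.torsionGaloisModule ((2 : ℕ) : ℤ)).tateDual 2) (Sum.inr v) 1 y ∈
          unramifiedSubgroup (GaloisRep.toLocal v ((W.torsionGaloisModule ((2 : ℕ) : ℤ)).tateDual 2)) 1) →
      ∑ v ∈ S, localTatePairingZMod (W.torsionGaloisModule ((2 : ℕ) : ℤ)) 2 v (LocalInvariants.canonical K 2 v) (t v)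
        (galoisCohomology.localization ((W.torsionGaloisModule ((2 : ℕ) : ℤ)).tateDual 2) v 1 y) = 0) :
    ∃ x : galoisCohomology (W.torsionGaloisModule ((2 : ℕ) : ℤ)) 1,
      (∀ v : HeightOneSpectrum (𝓞 K), (Sum.inr v : Place K) ∉ S →
        galoisCohomology.localization (W.torsionGaloisModule ((2 : ℕ) : ℤ)) (Sum.inr v) 1 x ∈
          unramifiedSubgroup (GaloisRep.toLocal v (W.torsionGaloisModule ((2 : ℕ) : ℤ))) 1) ∧
      ∀ v ∈ S, galoisCohomology.localization (W.torsionGaloisModule ((2 : ℕ) : ℤ)) v 1 x = t v := by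
  have h2 : ∀ Q : geomTorsion W ((2 : ℕ) : ℤ), 2 • Q = 0 := fun Q => Subtype.ext (by
    have h := (mem_geomTorsion_iff W ((2 : ℕ) : ℤ) (Q : geomPoints W)).mp Q.2
    rw [natCast_zsmul] at h
    exact h)
  haveI : NeZero ((2 : ℕ) : K) := ⟨by exact_mod_cast (two_ne_zero : (2 : K) ≠ 0)⟩
  have hcard : Nat.card (geomTorsion W ((2 : ℕ) : ℤ)) = 2 ^ 2 :=
    Literature.NumberTheory.EllipticCurves.natCard_geomTorsion W 2
  exact middleExact_canonical_torsionGaloisModule_two_of_pow W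
    (fun σ => pow_two_eq_one_of_fixed (W.torsionGaloisModule ((2 : ℕ) : ℤ)) h2 hcard hP0
      (fun τ => by rw [torsionGaloisModule_apply_apply]; exact hP τ) σ)
    hSinf hS t horth

end Summit.BirchSwinnertonDyer.BirchSwinnertonDyer.Theorems.SignedEC.MuReal

end
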